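import Mathlib
import Summits.ValiantsHypothesis.ValiantsHypothesis.Theorems.FifoMatchingNNNotVPSupportFnExpHard
import Summits.ValiantsHypothesis.ValiantsHypothesis.Theorems.FifoMatchingNNNotVPStubCertificateToSupportFn
import Summits.ValiantsHypothesis.ValiantsHypothesis.Theorems.FifoMatchingNNNotVPSpreadCofactorOfExpHard
import Summits.ValiantsHypothesis.ValiantsHypothesis.Theorems.FifoMatchingNNNotVPAfterStubA
import HarnessLib

/-!
# Route FifoMatching — crux `NNNotVP` (stmt-ValiantsHypothesis-11615), line `division_split`:
# stub B2 `stub_spreadCofactorReduction` IS the exponential division hardness of `NN`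

Registered line `Cruxes/NNNotVP/Lines/division_split.lean`; objects `σ` / `NN` / `SuppFn` /
`freeVars` = the line's vocabulary (`Theorems/FifoMatchingNNNotVPDivisionSplitDefs.lean`).

The registered OPEN stub B2 of the line reads (verbatim):

  `∃ k, ∀ n h, h ≠ 0 → ∃ h', (∃ m ∈ supp h', |supp m| ≤ (log₂ n + k)^k) ∧
      L₊(NN_n · h') ≤ 2^((log₂ n + log₂ (L₊(NN_n · h) + L₊(h)) + k)^k)`.

The tree holds `ExpDivisionHard(NN) ⟹ B2` (`spreadCofactorReduction_of_expDivisionHard`, ✓ p824326,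
the free cofactor `h' := 1`) and `B2 ⟹ NNDivisionHard` (✓ p821952), with exponential division hardness
spelled inline as `∃ r n₀, ∀ n ≥ n₀, ∀ h ≠ 0, n ≤ (log₂ (L₊(NN_n · h) + L₊(h)))^r`.  This file proves
the CONVERSE of the first implication and so pins the stub down BY NAME:

* `expDivisionHard_of_spreadCofactorReduction` — **B2 ⟹ ExpDivisionHard(NN)**: B2 trades any
  certificate `(h, NN_n h)` for a cofactor `h'` with a monomial `x^m` of polylog support at cost
  `L₊(NN_n h') ≤ 2^((log₂ n + log₂ cert + k)^k)`; freeing `supp m` (B1, `stub_certificateToSupportFn`,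
  ✓ p582087) gives a polynomial with the support function of `NN_n|_{supp m := 1}` and no larger `L₊`;
  stub A AT EXPONENTIAL RATE (`supportFnExpHard`: `n ≤ (log₂ L₊)^r`) then forces
  `n ≤ (log₂ n + log₂ cert + k)^(k r)`, i.e. `log₂ cert ≥ n^{1/(kr)} - log₂ n - k`, i.e.
  `n ≤ (log₂ cert)^(2 k r)` eventually;
* ★★ `spreadCofactorReduction_iff_expDivisionHard` — **B2 ⟺ ExpDivisionHard(NN)**;
* `nnDivisionHard_of_expDivisionHard` — the recorded corollary ExpDivisionHard(NN) ⟹ stmt-21181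
  (through B2 and ✓ p821952), so the line `division_split` now reads, by name,
  `NNNotVP ⟸ Z ∧ ExpDivisionHard(NN)` next to the split `NNNotVP ⟸ Z ∧ NNDivisionHard` (✓ `nnNotVP_of_subs`).

Honest framing: a CLASSIFICATION of an open registered stub — B2 is exactly the EXPONENTIAL form of
the sibling crux stmt-21181 (HY21 §6 Problem 2 for the nest-free matching polynomial, with one
division, at rate `2^{n^{Ω(1)}}`), hence at least as hard as 21181 itself; neither B2, nor 21181,
nor the crux `NNNotVP`, nor `VP ≠ VNP` is proved here.  No definitions, no named facts.
-/

noncomputable section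

-- Sub = Summit single-conjunct layout: the duplicated namespace component is mandated by the tree.
set_option linter.dupNamespace false

namespace Summit.ValiantsHypothesis.ValiantsHypothesis.Theorems.FifoMatching.NNNotVP.DivisionSplit

open MvPolynomial Finset Literature.Computability.AlgebraicComplexity
open scoped NNReal BigOperators Classical

/-- ★ **B2 ⟹ exponential division hardness of `NN`.**  If the spread-cofactor reduction holds
(stub B2 of line `division_split`, verbatim), then for some `r`, eventually in `n`, every nonzero
cofactor `h ∈ ℝ≥0[x]` has `n ≤ (log₂ (L₊(NN_n · h) + L₊(h)))^r`, i.e.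
`L₊(NN_n · h) + L₊(h) ≥ 2^{n^{1/r}}`. [folklore] -/
theorem expDivisionHard_of_spreadCofactorReduction
    (hB2 : ∃ k : ℕ, ∀ (n : ℕ) (h : MvPolynomial (σ n) ℝ≥0), h ≠ 0 →
      ∃ h' : MvPolynomial (σ n) ℝ≥0, (∃ m ∈ h'.support, m.support.card ≤ (Nat.log 2 n + k) ^ k) ∧
        complexity (NN n * h') ≤
          2 ^ ((Nat.log 2 n + Nat.log 2 (complexity (NN n * h) + complexity h) + k) ^ k)) :
    ∃ r n₀ : ℕ, ∀ n ≥ n₀, ∀ h : MvPolynomial (σ n) ℝ≥0, h ≠ 0 →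
      n ≤ (Nat.log 2 (complexity (NN n * h) + complexity h)) ^ r := by
  obtain ⟨k, hk⟩ := hB2
  obtain ⟨r, n₁, hA⟩ := supportFnExpHard k
  obtain ⟨n₂, hn₂⟩ := eventually_polylog_lt (2 * k + 2) (k * r)
  refine ⟨2 * (k * r), max n₁ n₂, fun n hn h hh => ?_⟩
  have hn1 : n₁ ≤ n := le_trans (le_max_left _ _) hn
  have hn2 : n₂ ≤ n := le_trans (le_max_right _ _) hn
  -- B2: a cheap certificate whose cofactor has a monomial of polylog support
  obtain ⟨h', ⟨m, hm, hcard⟩, hcost⟩ := hk n h hh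
  -- B1: a polynomial with the support function of `NN_n` with the arcs of `m` freed, no costlier
  obtain ⟨g, hg, hgc⟩ := stub_certificateToSupportFn n h' m hm
  -- stub A at exponential rate
  have hAn : n ≤ (Nat.log 2 (complexity g)) ^ r := hA n hn1 m.support hcard g hg
  set b : ℕ := Nat.log 2 (complexity (NN n * h) + complexity h) with hb
  set L : ℕ := Nat.log 2 n with hL
  have hlogg : Nat.log 2 (complexity g) ≤ (L + b + k) ^ k :=
    calc Nat.log 2 (complexity g) ≤ Nat.log 2 (complexity (NN n * h')) := Nat.log_mono_right hgc
      _ ≤ Nat.log 2 (2 ^ ((L + b + k) ^ k)) := Nat.log_mono_right hcost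
      _ = (L + b + k) ^ k := Nat.log_pow (by norm_num) _
  have hnk : n ≤ (L + b + k) ^ (k * r) :=
    calc n ≤ (Nat.log 2 (complexity g)) ^ r := hAn
      _ ≤ ((L + b + k) ^ k) ^ r := Nat.pow_le_pow_left hlogg r
      _ = (L + b + k) ^ (k * r) := by rw [← pow_mul]
  by_cases hbs : b ≤ L + k + 1
  · -- small `b`: `n ≤ (2L + 2k + 2)^(kr) < n`
    exfalso
    have h1 : n ≤ (2 * L + (2 * k + 2)) ^ (k * r) :=
      hnk.trans (Nat.pow_le_pow_left (by omega) _)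
    exact absurd (hn₂ n hn2) (not_lt.2 h1)
  · -- large `b`: `L + b + k < 2b ≤ b²`
    push Not at hbs
    have hb2 : L + b + k ≤ b ^ 2 := by nlinarith
    calc n ≤ (L + b + k) ^ (k * r) := hnk
      _ ≤ (b ^ 2) ^ (k * r) := Nat.pow_le_pow_left hb2 _
      _ = b ^ (2 * (k * r)) := by rw [← pow_mul]

/-- ★★ **Stub B2 ⟺ exponential division hardness of `NN`** (the registered
`stub_spreadCofactorReduction` of line `division_split`, verbatim on the left;
`expDivisionHard_of_spreadCofactorReduction` / `spreadCofactorReduction_of_expDivisionHard`).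
Both sides are OPEN; the stub is thereby classified as the `2^{n^{Ω(1)}}` form of the sibling crux
stmt-ValiantsHypothesis-21181. [folklore] -/
theorem spreadCofactorReduction_iff_expDivisionHard :
    (∃ k : ℕ, ∀ (n : ℕ) (h : MvPolynomial (σ n) ℝ≥0), h ≠ 0 →
      ∃ h' : MvPolynomial (σ n) ℝ≥0, (∃ m ∈ h'.support, m.support.card ≤ (Nat.log 2 n + k) ^ k) ∧
        complexity (NN n * h') ≤
          2 ^ ((Nat.log 2 n + Nat.log 2 (complexity (NN n * h) + complexity h) + k) ^ k)) ↔
    (∃ r n₀ : ℕ, ∀ n ≥ n₀, ∀ h : MvPolynomial (σ n) ℝ≥0, h ≠ 0 →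
      n ≤ (Nat.log 2 (complexity (NN n * h) + complexity h)) ^ r) :=
  ⟨expDivisionHard_of_spreadCofactorReduction,
    SpreadCofactorExpType.spreadCofactorReduction_of_expDivisionHard⟩

/-- **ExpDivisionHard(NN) ⟹ stmt-ValiantsHypothesis-21181** (`NNDivisionHard`, the crux's verbatim
statement), recorded for the census: through B2 (`spreadCofactorReduction_of_expDivisionHard`) and
the landed `nnDivisionHard_of_spreadCofactorReduction` (`…AfterStubA`).  (The direct route — an exponential
bound is eventually above every quasi-polynomial — is equally short; this one exhibits the chain
Exp ⟹ B2 ⟹ 21181 by name.) [folklore] -/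
theorem nnDivisionHard_of_expDivisionHard
    (hE : ∃ r n₀ : ℕ, ∀ n ≥ n₀, ∀ h : MvPolynomial (σ n) ℝ≥0, h ≠ 0 →
      n ≤ (Nat.log 2 (complexity (NN n * h) + complexity h)) ^ r) :
    Summit.ValiantsHypothesis.ValiantsHypothesis.Theses.FifoMatching.NNDivisionHard :=
  nnDivisionHard_of_spreadCofactorReduction
    (SpreadCofactorExpType.spreadCofactorReduction_of_expDivisionHard hE)

end Summit.ValiantsHypothesis.ValiantsHypothesis.Theorems.FifoMatching.NNNotVP.DivisionSplit

end
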